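import Mathlib.Analysis.Matrix.Spectrum
import Mathlib.Algebra.Algebra.Spectrum.Basic
import Literature.Computability.AlgebraicComplexity.QuantumFunctionalsProofs
import Summits.MatrixMultiplication.MatrixMultiplication.Theorems.FarEdgeDescentTwistedStarRigidity

/-!
# Quantum invisibility of the twist: `F^θ(𝔖_n(L)) = F^θ(⟨n,n,2L⟩)` for every `θ`

Route `FarEdgeDescent` (cell `decomp-mm`, lens 2 «structural dichotomy», gen 28), part 3;
support for the aside `SubLogRate` (stmt-MatrixMultiplication-25371) via its named idea
«Q-𝔖 / transpose cashing» (`Theorems/FarEdgeDescentTwistedStarCore.lean`).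
Parts 1–2 (`…PairingObstruction.lean`, `…TwistedStarRigidity.lean`) settle the FINITE half of the
dichotomy: no Kronecker power of `⟨n,n,2L⟩` is a degeneration of the same power of the twisted
star `𝔖_n(L)` (the tensor of `(X, Y, Y') ↦ (XY, XᵀY')`).  This file settles the SPECTRAL half for
the whole family of quantum functionals (Christandl–Vrana–Zuiddam, Def. 3.16): for every `θ ≥ 0`,
`E_θ(𝔖_n(L)) = E_θ(⟨n,n,2L⟩) = θ₁ log₂(2nL) + θ₂ log₂(n²) + θ₃ log₂(2nL)`, hence
`F^θ(𝔖_n(L)) = F^θ(⟨n,n,2L⟩)` (`logQuantumFunctional_twistedStar_eq`,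
`quantumFunctional_twistedStar_eq`, `twistedStar_dichotomy`).  So no quantum functional — over
`ℂ` the only universal spectral points known — separates `𝔖_n(L)` from `⟨n,n,2L⟩` in either
direction: «asymptotic transpose cashing» `𝔖_n(L) ≳ ⟨n,n,2L⟩` holds with equality for every
quantum functional, and its failure would exhibit a universal spectral point of `ℂ`-tensors that
is not a quantum functional.

Mechanism (elementary, no freeness needed): the three quantum marginals of both tensors are the
scalars `n`, `2L`, `n` in the standard basis (`reducedDensity₁/₂/₃_matMulTensor/_twistedStar`), so
`H_θ` at `A = B = C = 1` already equals the dimension bound of CVZ Thm. 3.19.5 and `E_θ` is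
attained there (`logQuantumFunctional_eq_of_scalar_marginals`); the formats have equal sizes.

References: M. Christandl, P. Vrana, J. Zuiddam, *Universal points in the asymptotic spectrum of
tensors*, J. AMS 36 (2023), Def. 3.15–3.16, Thm. 3.19. [ChristandlVranaZuiddam2023]
M. Bläser, *Fast Matrix Multiplication*, Theory of Computing, Graduate Surveys 5 (2013), §5.
[Blaser2013]
-/

noncomputable section

open scoped BigOperators

set_option linter.dupNamespace false
namespace Summit.MatrixMultiplication.MatrixMultiplication.Theorems.FarEdgeDescentQuantumTwin

open Literature.Computability.AlgebraicComplexity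
  Summit.MatrixMultiplication.MatrixMultiplication.Theorems.FarEdgeDescentTwistedStar
  Summit.MatrixMultiplication.MatrixMultiplication.Theorems.FarEdgeDescentPairingObstruction

/-! ### Maximally mixed marginals force `E_θ` to the dimension bound -/

section General
variable {ι κ μ : Type*} [Fintype ι] [Fintype κ] [Fintype μ] [DecidableEq ι] [DecidableEq κ]
  [DecidableEq μ]

/-- A Hermitian scalar matrix `c·1` has all eigenvalues equal to `c`. [folklore] -/
theorem eigenvalues_eq_of_eq_smul_one {A : Matrix ι ι ℂ} (hA : A.IsHermitian) {c : ℕ}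
    (h : A = (c : ℂ) • (1 : Matrix ι ι ℂ)) (i : ι) : hA.eigenvalues i = c := by
  haveI : Nonempty ι := ⟨i⟩
  have hA' : A = algebraMap ℝ (Matrix ι ι ℂ) (c : ℝ) := by
    rw [h, Algebra.algebraMap_eq_smul_one]
    ext j l
    simp [Matrix.smul_apply, Complex.real_smul]
  have hs : spectrum ℝ A = {(c : ℝ)} := by rw [hA']; exact spectrum.scalar_eq (c : ℝ)
  have hmem := hA.eigenvalues_mem_spectrum_real i
  rw [hs] at hmem
  exact Set.mem_singleton_iff.1 hmem

/-- Entropy of the uniform distribution: `H(1/|α|, …, 1/|α|) = log₂ |α|`. [folklore] -/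
theorem shannonEntropy_const_inv_card {α : Type*} [Fintype α] [Nonempty α] :
    shannonEntropy (fun _ : α => ((Fintype.card α : ℝ))⁻¹) =
      Real.log (Fintype.card α) / Real.log 2 := by
  have hpos : (0 : ℝ) < Fintype.card α := by exact_mod_cast Fintype.card_pos
  rw [shannonEntropy_def, Finset.sum_const, Finset.card_univ, nsmul_eq_mul, Real.negMulLog,
    Real.log_inv]
  congr 1
  field_simp

omit [DecidableEq κ] [DecidableEq μ] in
/-- If the first quantum marginal `|t⟩⟨t|₁` of `t ≠ 0` is a scalar matrix, the marginal spectrum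
`r₁(t)` is uniform. [folklore] -/
theorem marginalSpectrum₁_eq_const {t : ι → κ → μ → ℂ} (ht : t ≠ 0) {c : ℕ}
    (h : reducedDensity₁ t = (c : ℂ) • (1 : Matrix ι ι ℂ)) :
    marginalSpectrum₁ t = fun _ => ((Fintype.card ι : ℝ))⁻¹ := by
  have hv : ∀ i, marginalSpectrum₁ t i = c / tensorNormSq t := fun i => by
    simp only [marginalSpectrum₁, eigenvalues_eq_of_eq_smul_one (isHermitian_reducedDensity₁ t) h i]
  have hsum : ∑ i, marginalSpectrum₁ t i = 1 := (marginalSpectrum₁_mem_stdSimplex ht).2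
  simp_rw [hv, Finset.sum_const, Finset.card_univ, nsmul_eq_mul] at hsum
  exact funext fun i => (hv i).trans (inv_eq_of_mul_eq_one_right hsum).symm

omit [DecidableEq ι] [DecidableEq μ] in
/-- Same for the second marginal. [folklore] -/
theorem marginalSpectrum₂_eq_const {t : ι → κ → μ → ℂ} (ht : t ≠ 0) {c : ℕ}
    (h : reducedDensity₂ t = (c : ℂ) • (1 : Matrix κ κ ℂ)) :
    marginalSpectrum₂ t = fun _ => ((Fintype.card κ : ℝ))⁻¹ := by
  have hv : ∀ i, marginalSpectrum₂ t i = c / tensorNormSq t := fun i => by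
    simp only [marginalSpectrum₂, eigenvalues_eq_of_eq_smul_one (isHermitian_reducedDensity₂ t) h i]
  have hsum : ∑ i, marginalSpectrum₂ t i = 1 := (marginalSpectrum₂_mem_stdSimplex ht).2
  simp_rw [hv, Finset.sum_const, Finset.card_univ, nsmul_eq_mul] at hsum
  exact funext fun i => (hv i).trans (inv_eq_of_mul_eq_one_right hsum).symm

omit [DecidableEq ι] [DecidableEq κ] in
/-- Same for the third marginal. [folklore] -/
theorem marginalSpectrum₃_eq_const {t : ι → κ → μ → ℂ} (ht : t ≠ 0) {c : ℕ}
    (h : reducedDensity₃ t = (c : ℂ) • (1 : Matrix μ μ ℂ)) :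
    marginalSpectrum₃ t = fun _ => ((Fintype.card μ : ℝ))⁻¹ := by
  have hv : ∀ i, marginalSpectrum₃ t i = c / tensorNormSq t := fun i => by
    simp only [marginalSpectrum₃, eigenvalues_eq_of_eq_smul_one (isHermitian_reducedDensity₃ t) h i]
  have hsum : ∑ i, marginalSpectrum₃ t i = 1 := (marginalSpectrum₃_mem_stdSimplex ht).2
  simp_rw [hv, Finset.sum_const, Finset.card_univ, nsmul_eq_mul] at hsum
  exact funext fun i => (hv i).trans (inv_eq_of_mul_eq_one_right hsum).symm

/-- **Maximally mixed marginals attain the dimension bound.** If all three quantum marginals of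
`t ≠ 0` are scalar matrices in the standard basis, then
`E_θ(t) = θ₁ log₂|ι| + θ₂ log₂|κ| + θ₃ log₂|μ|` for every `θ ≥ 0`: the upper bound of CVZ
Thm. 3.19.5 is attained at `A = B = C = 1`. [cite: ChristandlVranaZuiddam2023, Thm. 3.19.5] -/
theorem logQuantumFunctional_eq_of_scalar_marginals {θ : Fin 3 → ℝ} (hθ : ∀ i, 0 ≤ θ i)
    {t : ι → κ → μ → ℂ} (ht : t ≠ 0) {c₁ c₂ c₃ : ℕ}
    (h₁ : reducedDensity₁ t = (c₁ : ℂ) • (1 : Matrix ι ι ℂ))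
    (h₂ : reducedDensity₂ t = (c₂ : ℂ) • (1 : Matrix κ κ ℂ))
    (h₃ : reducedDensity₃ t = (c₃ : ℂ) • (1 : Matrix μ μ ℂ)) :
    logQuantumFunctional θ t = θ 0 * (Real.log (Fintype.card ι) / Real.log 2) +
      θ 1 * (Real.log (Fintype.card κ) / Real.log 2) +
      θ 2 * (Real.log (Fintype.card μ) / Real.log 2) := by
  obtain ⟨a, ha⟩ := Function.ne_iff.1 ht
  obtain ⟨b, hb⟩ := Function.ne_iff.1 ha
  obtain ⟨c, _⟩ := Function.ne_iff.1 hb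
  haveI : Nonempty ι := ⟨a⟩; haveI : Nonempty κ := ⟨b⟩; haveI : Nonempty μ := ⟨c⟩
  refine le_antisymm (logQuantumFunctional_le hθ t) ?_
  have hq := quantumEntropy_le_logQuantumFunctional hθ t
  rwa [quantumEntropy, marginalSpectrum₁_eq_const ht h₁, marginalSpectrum₂_eq_const ht h₂,
    marginalSpectrum₃_eq_const ht h₃, shannonEntropy_const_inv_card,
    shannonEntropy_const_inv_card, shannonEntropy_const_inv_card] at hq

end General

/-! ### The Gram matrices of `⟨k,m,p⟩` are the scalars `m`, `p`, `k` -/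

section MatMul
variable (k m p : ℕ)

/-- `star` fixes the `0/1` entries of `⟨k,m,p⟩`. [folklore] -/
@[simp] theorem star_matMulTensor (a : Fin k × Fin p) (b : Fin k × Fin m) (c : Fin m × Fin p) :
    star (matMulTensor ℂ k m p a b c) = matMulTensor ℂ k m p a b c := by
  unfold matMulTensor
  split_ifs <;> simp

/-- The entries of `⟨k,m,p⟩` are idempotent. [folklore] -/
theorem matMulTensor_mul_self (a : Fin k × Fin p) (b : Fin k × Fin m) (c : Fin m × Fin p) :
    matMulTensor ℂ k m p a b c * matMulTensor ℂ k m p a b c = matMulTensor ℂ k m p a b c := by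
  unfold matMulTensor
  split_ifs <;> simp

/-- `∑_{b,c} ⟨k,m,p⟩_{abc} conj ⟨k,m,p⟩_{a'bc} = m·[a = a']`. [folklore] -/
theorem gram₁_matMulTensor (a a' : Fin k × Fin p) :
    ∑ b : Fin k × Fin m, ∑ c : Fin m × Fin p,
      matMulTensor ℂ k m p a b c * star (matMulTensor ℂ k m p a' b c) =
      if a = a' then (m : ℂ) else 0 := by
  by_cases haa : a = a'
  · subst haa
    simp only [if_true, star_matMulTensor, matMulTensor_mul_self]
    have hin : ∀ b : Fin k × Fin m, ∑ c : Fin m × Fin p, matMulTensor ℂ k m p a b c =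
        if a.1 = b.1 then 1 else 0 := fun b => by
      rw [Finset.sum_eq_single (b.2, a.2)]
      · unfold matMulTensor; by_cases h : a.1 = b.1 <;> simp [h]
      · exact fun c _ hc => if_neg fun ⟨_, h1, h2⟩ => hc (Prod.ext h1.symm h2.symm)
      · simp
    simp_rw [hin]
    rw [Fintype.sum_prod_type, Finset.sum_comm]
    simp only [Finset.sum_ite_eq, Finset.mem_univ, if_true, Finset.sum_const, Finset.card_univ,
      Fintype.card_fin, nsmul_eq_mul, mul_one]
  · rw [if_neg haa]
    refine Finset.sum_eq_zero fun b _ => Finset.sum_eq_zero fun c _ => ?_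
    rw [star_matMulTensor]; unfold matMulTensor
    split_ifs with h1 h2
    · exact absurd (Prod.ext (h1.1.trans h2.1.symm) (h1.2.2.trans h2.2.2.symm)) haa
    all_goals simp

/-- `∑_{a,c} ⟨k,m,p⟩_{abc} conj ⟨k,m,p⟩_{ab'c} = p·[b = b']`. [folklore] -/
theorem gram₂_matMulTensor (b b' : Fin k × Fin m) :
    ∑ a : Fin k × Fin p, ∑ c : Fin m × Fin p,
      matMulTensor ℂ k m p a b c * star (matMulTensor ℂ k m p a b' c) =
      if b = b' then (p : ℂ) else 0 := by
  by_cases hbb : b = b'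
  · subst hbb
    simp only [if_true, star_matMulTensor, matMulTensor_mul_self]
    have hin : ∀ a : Fin k × Fin p, ∑ c : Fin m × Fin p, matMulTensor ℂ k m p a b c =
        if a.1 = b.1 then 1 else 0 := fun a => by
      rw [Finset.sum_eq_single (b.2, a.2)]
      · unfold matMulTensor; by_cases h : a.1 = b.1 <;> simp [h]
      · exact fun c _ hc => if_neg fun ⟨_, h1, h2⟩ => hc (Prod.ext h1.symm h2.symm)
      · simp
    simp_rw [hin]
    rw [Fintype.sum_prod_type, Finset.sum_comm]
    simp only [Finset.sum_ite_eq', Finset.mem_univ, if_true, Finset.sum_const, Finset.card_univ,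
      Fintype.card_fin, nsmul_eq_mul, mul_one]
  · rw [if_neg hbb]
    refine Finset.sum_eq_zero fun a _ => Finset.sum_eq_zero fun c _ => ?_
    rw [star_matMulTensor]; unfold matMulTensor
    split_ifs with h1 h2
    · exact absurd (Prod.ext (h1.1.symm.trans h2.1) (h1.2.1.trans h2.2.1.symm)) hbb
    all_goals simp

/-- `∑_{a,b} ⟨k,m,p⟩_{abc} conj ⟨k,m,p⟩_{abc'} = k·[c = c']`. [folklore] -/
theorem gram₃_matMulTensor (c c' : Fin m × Fin p) :
    ∑ a : Fin k × Fin p, ∑ b : Fin k × Fin m,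
      matMulTensor ℂ k m p a b c * star (matMulTensor ℂ k m p a b c') =
      if c = c' then (k : ℂ) else 0 := by
  by_cases hcc : c = c'
  · subst hcc
    simp only [if_true, star_matMulTensor, matMulTensor_mul_self]
    have hin : ∀ a : Fin k × Fin p, ∑ b : Fin k × Fin m, matMulTensor ℂ k m p a b c =
        if a.2 = c.2 then 1 else 0 := fun a => by
      rw [Finset.sum_eq_single (a.1, c.1)]
      · unfold matMulTensor; by_cases h : a.2 = c.2 <;> simp [h]
      · exact fun b _ hb => if_neg fun ⟨h1, h2, _⟩ => hb (Prod.ext h1.symm h2)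
      · simp
    simp_rw [hin]
    rw [Fintype.sum_prod_type]
    simp only [Finset.sum_ite_eq', Finset.mem_univ, if_true, Finset.sum_const, Finset.card_univ,
      Fintype.card_fin, nsmul_eq_mul, mul_one]
  · rw [if_neg hcc]
    refine Finset.sum_eq_zero fun a _ => Finset.sum_eq_zero fun b _ => ?_
    rw [star_matMulTensor]; unfold matMulTensor
    split_ifs with h1 h2
    · exact absurd (Prod.ext (h1.2.1.symm.trans h2.2.1) (h1.2.2.symm.trans h2.2.2)) hcc
    all_goals simp

/-- `|⟨k,m,p⟩⟩⟨⟨k,m,p⟩|₁ = m·1`. [folklore] -/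
theorem reducedDensity₁_matMulTensor :
    reducedDensity₁ (matMulTensor ℂ k m p) = (m : ℂ) • 1 := by
  ext a a'
  rw [reducedDensity₁_apply, gram₁_matMulTensor, Matrix.smul_apply, Matrix.one_apply, smul_eq_mul,
    mul_ite, mul_one, mul_zero]

/-- `|⟨k,m,p⟩⟩⟨⟨k,m,p⟩|₂ = p·1`. [folklore] -/
theorem reducedDensity₂_matMulTensor :
    reducedDensity₂ (matMulTensor ℂ k m p) = (p : ℂ) • 1 := by
  ext b b'
  rw [reducedDensity₂_apply, gram₂_matMulTensor, Matrix.smul_apply, Matrix.one_apply, smul_eq_mul,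
    mul_ite, mul_one, mul_zero]

/-- `|⟨k,m,p⟩⟩⟨⟨k,m,p⟩|₃ = k·1`. [folklore] -/
theorem reducedDensity₃_matMulTensor :
    reducedDensity₃ (matMulTensor ℂ k m p) = (k : ℂ) • 1 := by
  ext c c'
  rw [reducedDensity₃_apply, gram₃_matMulTensor, Matrix.smul_apply, Matrix.one_apply, smul_eq_mul,
    mul_ite, mul_one, mul_zero]

/-- `⟨k,m,p⟩ ≠ 0` for positive formats. [folklore] -/
theorem matMulTensor_ne_zero (hk : 1 ≤ k) (hm : 1 ≤ m) (hp : 1 ≤ p) : matMulTensor ℂ k m p ≠ 0 := by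
  intro h
  have := congrFun (congrFun (congrFun h (⟨0, hk⟩, ⟨0, hp⟩)) (⟨0, hk⟩, ⟨0, hm⟩)) (⟨0, hm⟩, ⟨0, hp⟩)
  simp [matMulTensor] at this

/-- **`E_θ(⟨k,m,p⟩) = θ₁ log₂(kp) + θ₂ log₂(km) + θ₃ log₂(mp)`** for `θ ≥ 0` and positive
formats. [cite: ChristandlVranaZuiddam2023, Thm. 3.19.5] -/
theorem logQuantumFunctional_matMulTensor {θ : Fin 3 → ℝ} (hθ : ∀ i, 0 ≤ θ i) (hk : 1 ≤ k)
    (hm : 1 ≤ m) (hp : 1 ≤ p) :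
    logQuantumFunctional θ (matMulTensor ℂ k m p) = θ 0 * (Real.log (k * p) / Real.log 2) +
      θ 1 * (Real.log (k * m) / Real.log 2) + θ 2 * (Real.log (m * p) / Real.log 2) := by
  rw [logQuantumFunctional_eq_of_scalar_marginals hθ (matMulTensor_ne_zero k m p hk hm hp)
    (reducedDensity₁_matMulTensor k m p) (reducedDensity₂_matMulTensor k m p)
    (reducedDensity₃_matMulTensor k m p)]
  simp only [Fintype.card_prod, Fintype.card_fin]
  push_cast
  ring

end MatMul

/-! ### The Gram matrices of `𝔖_n(L)` are the same scalars `n`, `2L`, `n` -/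

section TwistedStar
variable (n L : ℕ)

/-- `|𝔖⟩⟨𝔖|₁ = n·1`. [folklore] -/
theorem reducedDensity₁_twistedStar :
    reducedDensity₁ (twistedStar ℂ n L) = (n : ℂ) • 1 := by
  ext x x'
  rw [reducedDensity₁_apply, Matrix.smul_apply, Matrix.one_apply, smul_eq_mul, mul_ite, mul_one,
    mul_zero]
  simp_rw [Fintype.sum_sum_type, Finset.sum_add_distrib]
  rcases x with a | a <;> rcases x' with a' | a'
  · simp only [twistedStar_inl_inl, twistedStar_inl_inr, star_zero, mul_zero, Finset.sum_const_zero,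
      add_zero, Sum.inl.injEq]
    exact gram₁_matMulTensor n n L a a'
  · simp
  · simp
  · simp only [twistedStar_inr_inl, twistedStar_inr_inr, zero_mul, Finset.sum_const_zero, zero_add,
      Sum.inr.injEq]
    rw [show (∑ b : Fin n × Fin n, ∑ c : Fin n × Fin L, matMulTensor ℂ n n L a b.swap c *
        star (matMulTensor ℂ n n L a' b.swap c)) = ∑ b : Fin n × Fin n, ∑ c : Fin n × Fin L,
        matMulTensor ℂ n n L a b c * star (matMulTensor ℂ n n L a' b c) from
      Fintype.sum_equiv (Equiv.prodComm _ _) _ _ (fun b => rfl)]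
    exact gram₁_matMulTensor n n L a a'

/-- `|𝔖⟩⟨𝔖|₂ = 2L·1`. [folklore] -/
theorem reducedDensity₂_twistedStar :
    reducedDensity₂ (twistedStar ℂ n L) = ((L + L : ℕ) : ℂ) • 1 := by
  ext b b'
  rw [reducedDensity₂_apply, Matrix.smul_apply, Matrix.one_apply, smul_eq_mul, mul_ite, mul_one,
    mul_zero, Fintype.sum_sum_type]
  simp_rw [Fintype.sum_sum_type]
  simp only [twistedStar_inl_inl, twistedStar_inl_inr, twistedStar_inr_inl, twistedStar_inr_inr,
    zero_mul, Finset.sum_const_zero, add_zero, zero_add]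
  rw [gram₂_matMulTensor, gram₂_matMulTensor]
  by_cases h : b = b'
  · subst h
    simp only [if_true]
    push_cast
    ring
  · rw [if_neg h, if_neg (fun h' => h (Prod.swap_inj.1 h')), if_neg h, add_zero]

/-- `|𝔖⟩⟨𝔖|₃ = n·1`. [folklore] -/
theorem reducedDensity₃_twistedStar :
    reducedDensity₃ (twistedStar ℂ n L) = (n : ℂ) • 1 := by
  ext x x'
  rw [reducedDensity₃_apply, Matrix.smul_apply, Matrix.one_apply, smul_eq_mul, mul_ite, mul_one,
    mul_zero, Fintype.sum_sum_type]
  rcases x with c | c <;> rcases x' with c' | c'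
  · simp only [twistedStar_inl_inl, twistedStar_inr_inl, star_zero, mul_zero, Finset.sum_const_zero,
      add_zero, Sum.inl.injEq]
    exact gram₃_matMulTensor n n L c c'
  · simp
  · simp
  · simp only [twistedStar_inl_inr, twistedStar_inr_inr, zero_mul, Finset.sum_const_zero, zero_add,
      Sum.inr.injEq]
    rw [show (∑ a : Fin n × Fin L, ∑ b : Fin n × Fin n, matMulTensor ℂ n n L a b.swap c *
        star (matMulTensor ℂ n n L a b.swap c')) = ∑ a : Fin n × Fin L, ∑ b : Fin n × Fin n,
        matMulTensor ℂ n n L a b c * star (matMulTensor ℂ n n L a b c') from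
      Finset.sum_congr rfl fun a _ => Fintype.sum_equiv (Equiv.prodComm _ _) _ _ (fun b => rfl)]
    exact gram₃_matMulTensor n n L c c'

/-- `𝔖_n(L) ≠ 0` for `n, L ≥ 1`. [folklore] -/
theorem twistedStar_ne_zero (hn : 1 ≤ n) (hL : 1 ≤ L) : twistedStar ℂ n L ≠ 0 := by
  intro h
  have := congrFun (congrFun (congrFun h (Sum.inl (⟨0, hn⟩, ⟨0, hL⟩))) (⟨0, hn⟩, ⟨0, hn⟩))
    (Sum.inl (⟨0, hn⟩, ⟨0, hL⟩))
  simp [matMulTensor] at this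

/-- **`E_θ(𝔖_n(L)) = θ₁ log₂(2nL) + θ₂ log₂(n²) + θ₃ log₂(2nL)`** for `θ ≥ 0`, `n, L ≥ 1`.
[cite: ChristandlVranaZuiddam2023, Thm. 3.19.5] -/
theorem logQuantumFunctional_twistedStar {θ : Fin 3 → ℝ} (hθ : ∀ i, 0 ≤ θ i) (hn : 1 ≤ n)
    (hL : 1 ≤ L) :
    logQuantumFunctional θ (twistedStar ℂ n L) = θ 0 * (Real.log (n * (L + L)) / Real.log 2) +
      θ 1 * (Real.log (n * n) / Real.log 2) + θ 2 * (Real.log (n * (L + L)) / Real.log 2) := by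
  rw [logQuantumFunctional_eq_of_scalar_marginals hθ (twistedStar_ne_zero n L hn hL)
    (reducedDensity₁_twistedStar n L) (reducedDensity₂_twistedStar n L)
    (reducedDensity₃_twistedStar n L)]
  simp only [Fintype.card_sum, Fintype.card_prod, Fintype.card_fin]
  push_cast
  ring

/-- **Quantum invisibility of the twist (logarithmic form).** `E_θ(𝔖_n(L)) = E_θ(⟨n,n,2L⟩)` for
every `θ ≥ 0` (`n, L ≥ 1`). [cite: ChristandlVranaZuiddam2023, Def. 3.16] -/
theorem logQuantumFunctional_twistedStar_eq {θ : Fin 3 → ℝ} (hθ : ∀ i, 0 ≤ θ i) (hn : 1 ≤ n)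
    (hL : 1 ≤ L) :
    logQuantumFunctional θ (twistedStar ℂ n L) =
      logQuantumFunctional θ (matMulTensor ℂ n n (L + L)) := by
  rw [logQuantumFunctional_twistedStar n L hθ hn hL,
    logQuantumFunctional_matMulTensor n n (L + L) hθ hn hn (le_trans hL (Nat.le_add_right L L))]
  push_cast
  ring

/-- **Quantum invisibility of the twist.** `F^θ(𝔖_n(L)) = F^θ(⟨n,n,2L⟩)` for every `θ ≥ 0`
(`n, L ≥ 1`): no quantum functional separates the twisted star from `⟨n,n,2L⟩`, in either
direction. [cite: ChristandlVranaZuiddam2023, Def. 3.16] -/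
theorem quantumFunctional_twistedStar_eq (θ : Fin 3 → ℝ) (hθ : ∀ i, 0 ≤ θ i) (hn : 1 ≤ n)
    (hL : 1 ≤ L) :
    quantumFunctional θ (twistedStar ℂ n L) = quantumFunctional θ (matMulTensor ℂ n n (L + L)) := by
  rw [quantumFunctional_of_ne_zero θ (twistedStar_ne_zero n L hn hL),
    quantumFunctional_of_ne_zero θ
      (matMulTensor_ne_zero n n (L + L) hn hn (le_trans hL (Nat.le_add_right L L))),
    logQuantumFunctional_twistedStar_eq n L hθ hn hL]

/-- **The dichotomy, both halves as theorems** (`n ≥ 2L ≥ 2`, `N ≥ 1`, `θ ≥ 0`): `⟨n,n,2L⟩^{⊠N}`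
is NOT a degeneration of `𝔖_n(L)^{⊠N}` (part 2), yet every quantum functional takes the same
value on `𝔖_n(L)` and `⟨n,n,2L⟩`. [cite: ChristandlVranaZuiddam2023, Def. 3.16] -/
theorem twistedStar_dichotomy (N : ℕ) (hL : 1 ≤ L) (h2 : L + L ≤ n) (hN : 1 ≤ N) (θ : Fin 3 → ℝ)
    (hθ : ∀ i, 0 ≤ θ i) :
    ¬ AlgDegeneratesTo (kroneckerPow (twistedStar ℂ n L) N)
        (kroneckerPow (matMulTensor ℂ n n (L + L)) N) ∧
      quantumFunctional θ (twistedStar ℂ n L) = quantumFunctional θ (matMulTensor ℂ n n (L + L)) :=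
  ⟨twistedStar_pow_not_algDegeneratesTo n L N hL h2 hN,
    quantumFunctional_twistedStar_eq n L θ hθ (le_trans (le_trans hL (Nat.le_add_right L L)) h2) hL⟩

end TwistedStar

end Summit.MatrixMultiplication.MatrixMultiplication.Theorems.FarEdgeDescentQuantumTwin

end
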